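import Literature.Analysis.FluidPDE.TwoHalfWeakEuler
import HarnessLib

/-!
# Planar sections of `2½`-dimensional fields: the descent `T³ → T²`

Analysis/FluidPDE support file (all proved). The accepted files
`Literature/Analysis/FunctionSpaces/TorusPlanarLift`, `Literature/Analysis/FluidPDE/TwoHalfNavierStokes`
and `Literature/Analysis/FluidPDE/TwoHalfWeakEuler` develop the *lift* direction of the
two-and-a-half-dimensional bookkeeping (Majda–Bertozzi 2002, §2.3.1; Bardos–Titi–Wiedemann 2012,
proof of Cor. 2): properties of the planar data `V : T² → ℝ²`, `R : T² → ℝ` are transported to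
the field `twoHalf V R = (V, R) ∘ π` on `T³`. This file records the converse *descent*: every
property of `twoHalf V R` that is expressed through integrals over `T³`, pointwise calculus or
measurability is inherited by the planar sections `V` and `R`. Contents:

* pointwise recovery of the sections (`planarProjE_twoHalf_planarSect`, `twoHalf_planarSect_two`)
  and the section of an `x₃`-invariant field (`eq_twoHalf_of_forall_add_single'`, index `2`);
* smoothness, divergence, zero mean (`isSmooth_left_of_twoHalf`, `isSmooth_right_of_twoHalf`, `isDivFree_of_twoHalf`,
  `hasZeroMean_of_twoHalf`);
* measurability of the sections, slice-wise and jointly in time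
  (`aestronglyMeasurable_of_twoHalf_left/right`, `aestronglyMeasurable_uncurry_of_twoHalf_left/right`);
* `Lᵖ` comparison `‖V‖_p, ‖R‖_p ≤ ‖(V,R)∘π‖_p`, `MemLp` descent, the `L²` energy identity
  `∫‖(V,R)∘π‖² = ∫‖V‖² + ∫R²` for `L²` data, and the lower-integral comparison
  `∫⁻‖V‖ₑ² ≤ ∫⁻‖(V,R)∘π‖ₑ²` (no measurability);
* weak incompressibility of the planar section (`isWeaklyDivFree_of_twoHalf`).

## References

* A. J. Majda, A. L. Bertozzi, *Vorticity and Incompressible Flow* (CUP 2002), §2.3.1,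
  Prop. 2.7 (two-and-a-half-dimensional flows).
* C. Bardos, E. S. Titi, E. Wiedemann, C. R. Math. Acad. Sci. Paris 350 (2012), proof of Cor. 2.
-/

open MeasureTheory Set Filter Topology Function UnitAddTorus
open scoped ENNReal NNReal InnerProductSpace
open Literature.Analysis.FunctionSpaces.Torus

noncomputable section

namespace Literature.Analysis.FluidPDE

namespace Torus


/-! ## Pointwise recovery of the sections -/

section Pointwise

variable (V : (UnitAddTorus (Fin 2)) → (EuclideanSpace ℝ (Fin 2))) (R : (UnitAddTorus (Fin 2)) → ℝ)

/-- The planar section recovers the planar datum: `πE ((V,R)∘π (σ y)) = V y`. [folklore] -/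
@[simp]
theorem planarProjE_twoHalf_planarSect (y : (UnitAddTorus (Fin 2))) : planarProjE (twoHalf V R (planarSect y)) = V y := by
  rw [twoHalf, planarProjE_planarEmbed, planarProj_planarSect]

/-- The planar section recovers the vertical datum: `((V,R)∘π (σ y))₂ = R y`. [folklore] -/
@[simp]
theorem twoHalf_planarSect_two (y : (UnitAddTorus (Fin 2))) : twoHalf V R (planarSect y) 2 = R y := by
  rw [twoHalf_apply_two, planarProj_planarSect]

/-- `(V,R)∘π ∘ σ = (V,R)` as the planar pairing. [folklore] -/
theorem twoHalf_planarSect (y : (UnitAddTorus (Fin 2))) : twoHalf V R (planarSect y) = planarEmbed (V y, R y) := by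
  rw [twoHalf, planarProj_planarSect]

/-- `twoHalf` is injective in the planar datum. [folklore] -/
theorem twoHalf_left_injective {V V' : (UnitAddTorus (Fin 2)) → (EuclideanSpace ℝ (Fin 2))} {R R' : (UnitAddTorus (Fin 2)) → ℝ} (h : twoHalf V R = twoHalf V' R') :
    V = V' := by
  funext y
  rw [← planarProjE_twoHalf_planarSect V R y, h, planarProjE_twoHalf_planarSect]

/-- `twoHalf` is injective in the vertical datum. [folklore] -/
theorem twoHalf_right_injective {V V' : (UnitAddTorus (Fin 2)) → (EuclideanSpace ℝ (Fin 2))} {R R' : (UnitAddTorus (Fin 2)) → ℝ} (h : twoHalf V R = twoHalf V' R') :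
    R = R' := by
  funext y
  rw [← twoHalf_planarSect_two V R y, h, twoHalf_planarSect_two]

/-- **An `x₃`-invariant field on `T³` is the `2½`-dimensional field of its sections** (the index
of the vertical axis written as the numeral `2 : Fin 3`). [folklore] -/
theorem eq_twoHalf_of_forall_add_single' {f : (UnitAddTorus (Fin 3)) → (EuclideanSpace ℝ (Fin 3))}
    (hf : ∀ (s : UnitAddCircle) (x : (UnitAddTorus (Fin 3))), f (x + Pi.single (2 : Fin 3) s) = f x) :
    f = twoHalf (fun y => planarProjE (f (planarSect y))) (fun y => f (planarSect y) 2) :=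
  eq_twoHalf_of_forall_add_single hf

/-- Planar norms are dominated pointwise: `‖V (π x)‖ ≤ ‖(V,R)∘π (x)‖`. [folklore] -/
theorem norm_left_le_norm_twoHalf (x : (UnitAddTorus (Fin 3))) : ‖V (planarProj x)‖ ≤ ‖twoHalf V R x‖ := by
  have h := norm_sq_twoHalf V R x
  nlinarith [sq_nonneg (R (planarProj x)), norm_nonneg (V (planarProj x)), norm_nonneg (twoHalf V R x)]

/-- Vertical values are dominated pointwise: `‖R (π x)‖ ≤ ‖(V,R)∘π (x)‖`. [folklore] -/
theorem norm_right_le_norm_twoHalf (x : (UnitAddTorus (Fin 3))) : ‖R (planarProj x)‖ ≤ ‖twoHalf V R x‖ := by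
  have h := norm_sq_twoHalf V R x
  rw [Real.norm_eq_abs]
  nlinarith [sq_nonneg (R (planarProj x)), sq_abs (R (planarProj x)), abs_nonneg (R (planarProj x)),
    norm_nonneg (V (planarProj x)), norm_nonneg (twoHalf V R x)]

end Pointwise

/-! ## Smoothness, divergence, mean -/

section Calculus

variable {V : (UnitAddTorus (Fin 2)) → (EuclideanSpace ℝ (Fin 2))} {R : (UnitAddTorus (Fin 2)) → ℝ}

/-- The planar section of a smooth `2½`-dimensional field is smooth. [folklore] -/
theorem isSmooth_left_of_twoHalf (h : IsSmooth (twoHalf V R)) : IsSmooth V := by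
  have h1 : IsSmooth (planarProjE ∘ (twoHalf V R ∘ planarSect)) := (h.comp_planarSect).comp_clm planarProjE
  have h2 : planarProjE ∘ (twoHalf V R ∘ planarSect) = V := funext fun y => planarProjE_twoHalf_planarSect V R y
  rwa [h2] at h1

/-- The vertical section of a smooth `2½`-dimensional field is smooth. [folklore] -/
theorem isSmooth_right_of_twoHalf (h : IsSmooth (twoHalf V R)) : IsSmooth R := by
  have h1 : IsSmooth ((EuclideanSpace.proj (2 : Fin 3) : (EuclideanSpace ℝ (Fin 3)) →L[ℝ] ℝ) ∘ (twoHalf V R ∘ planarSect)) :=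
    (h.comp_planarSect).comp_clm _
  have h2 : ((EuclideanSpace.proj (2 : Fin 3) : (EuclideanSpace ℝ (Fin 3)) →L[ℝ] ℝ) ∘ (twoHalf V R ∘ planarSect)) = R :=
    funext fun y => twoHalf_planarSect_two V R y
  rwa [h2] at h1

/-- The planar section of a divergence-free `2½`-dimensional field is divergence free
(`div (V,R)∘π = (div V) ∘ π`, and `π ∘ σ = id`). [folklore] -/
theorem isDivFree_of_twoHalf (h : IsDivFree (twoHalf V R)) : IsDivFree V := by
  intro y
  have h1 := h (planarSect y)
  rwa [divergence_twoHalf, Function.comp_apply, planarProj_planarSect] at h1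

/-- The mean of a `2½`-dimensional field with integrable data:
`∫_{T³} (V,R)∘π = (∫V, ∫R)` embedded. [folklore] -/
theorem integral_twoHalf (hV : Integrable V volume) (hR : Integrable R volume) :
    ∫ x, twoHalf V R x = planarEmbed (∫ y, V y, ∫ y, R y) := by
  rw [twoHalf_eq_comp,
    show (∫ x : (UnitAddTorus (Fin 3)), ((fun y => planarEmbed (V y, R y)) ∘ planarProj) x) =
      ∫ x : (UnitAddTorus (Fin 3)), (fun y => planarEmbed (V y, R y)) (planarProj x) from rfl,
    integral_comp_planarProj (planarEmbed.continuous.comp_aestronglyMeasurable (hV.1.prodMk hR.1)),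
    planarEmbed.integral_comp_comm (hV.prodMk hR), integral_pair hV hR]

/-- **Zero mean descends to the sections**: if `(V,R)∘π` has zero mean on `T³` and `V`, `R` are
integrable, then `∫V = 0` and `∫R = 0`. [folklore] -/
theorem hasZeroMean_of_twoHalf (hV : Integrable V volume) (hR : Integrable R volume)
    (h : HasZeroMean (twoHalf V R)) : HasZeroMean V ∧ HasZeroMean R := by
  unfold HasZeroMean at h ⊢
  rw [integral_twoHalf hV hR] at h
  constructor
  · have h1 := congrArg planarProjE h
    rwa [planarProjE_planarEmbed, map_zero] at h1
  · have h1 := congrArg (fun w : (EuclideanSpace ℝ (Fin 3)) => w 2) h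
    simpa only [planarEmbed_apply_two, PiLp.zero_apply] using h1

end Calculus

/-! ## Measurability of the sections -/

section Measurability

variable {V : (UnitAddTorus (Fin 2)) → (EuclideanSpace ℝ (Fin 2))} {R : (UnitAddTorus (Fin 2)) → ℝ}

/-- The planar pairing `y ↦ (V y, R y)` embedded in `ℝ³` is measurable as soon as `(V,R)∘π` is
(it is the planar section of the third-axis average of the invariant field `(V,R)∘π`). [folklore] -/
theorem aestronglyMeasurable_twoHalf_comp_planarSect (h : AEStronglyMeasurable (twoHalf V R) volume) :
    AEStronglyMeasurable (twoHalf V R ∘ planarSect) (volume : Measure (UnitAddTorus (Fin 2))) := by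
  have h1 := aestronglyMeasurable_axisAvg_comp_planarSect h
  rwa [axisAvg_eq_self_of_forall_add_single (twoHalf_add_single V R)] at h1

/-- The planar section of a measurable `2½`-dimensional field is measurable. [folklore] -/
theorem aestronglyMeasurable_of_twoHalf_left (h : AEStronglyMeasurable (twoHalf V R) volume) :
    AEStronglyMeasurable V volume := by
  have h1 := planarProjE.continuous.comp_aestronglyMeasurable (aestronglyMeasurable_twoHalf_comp_planarSect h)
  have h2 : (fun y => planarProjE ((twoHalf V R ∘ planarSect) y)) = V :=
    funext fun y => planarProjE_twoHalf_planarSect V R y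
  rwa [h2] at h1

/-- The vertical section of a measurable `2½`-dimensional field is measurable. [folklore] -/
theorem aestronglyMeasurable_of_twoHalf_right (h : AEStronglyMeasurable (twoHalf V R) volume) :
    AEStronglyMeasurable R volume := by
  have h1 := (EuclideanSpace.proj (2 : Fin 3) : (EuclideanSpace ℝ (Fin 3)) →L[ℝ] ℝ).continuous.comp_aestronglyMeasurable
    (aestronglyMeasurable_twoHalf_comp_planarSect h)
  have h2 : (fun y => (EuclideanSpace.proj (2 : Fin 3) : (EuclideanSpace ℝ (Fin 3)) →L[ℝ] ℝ) ((twoHalf V R ∘ planarSect) y)) = R :=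
    funext fun y => twoHalf_planarSect_two V R y
  rwa [h2] at h1

/-- The shear `((t, y), s) ↦ (t, σ y + s e₃)` preserves the product measures. [folklore] -/
theorem measurePreserving_timePlanarShear (S : Set ℝ) :
    MeasurePreserving (fun q : (ℝ × (UnitAddTorus (Fin 2))) × UnitAddCircle => (q.1.1, planarShear (q.1.2, q.2)))
      (((volume.restrict S).prod (volume : Measure (UnitAddTorus (Fin 2)))).prod (volume : Measure UnitAddCircle))
      ((volume.restrict S).prod (volume : Measure (UnitAddTorus (Fin 3)))) := by
  have h1 := (MeasurePreserving.id (volume.restrict S)).prod measurePreserving_planarShear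
  have h2 := measurePreserving_prodAssoc (volume.restrict S) (volume : Measure (UnitAddTorus (Fin 2))) (volume : Measure UnitAddCircle)
  exact h1.comp h2

variable {S : Set ℝ} {v : ℝ → (UnitAddTorus (Fin 2)) → (EuclideanSpace ℝ (Fin 2))} {θ : ℝ → (UnitAddTorus (Fin 2)) → ℝ}

/-- **Joint measurability of the planar pairing** of a time-dependent `2½`-dimensional field that
is jointly measurable on `S × T³`: `(t, y) ↦ ((v t, θ t)∘π)(σ y)` is jointly measurable on
`S × T²` (it is the vertical average `∫ u(t, σ y + s e₃) ds` of the invariant field). [folklore] -/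
theorem aestronglyMeasurable_uncurry_twoHalf_comp_planarSect
    (h : AEStronglyMeasurable (uncurry fun t => twoHalf (v t) (θ t)) ((volume.restrict S).prod (volume : Measure (UnitAddTorus (Fin 3))))) :
    AEStronglyMeasurable (uncurry fun t => twoHalf (v t) (θ t) ∘ planarSect)
      ((volume.restrict S).prod (volume : Measure (UnitAddTorus (Fin 2)))) := by
  have h1 := (h.comp_measurePreserving (measurePreserving_timePlanarShear S)).integral_prod_right'
  refine h1.congr (ae_of_all _ fun p => ?_)
  obtain ⟨t, y⟩ := p
  show (∫ s : UnitAddCircle, twoHalf (v t) (θ t) (planarShear (y, s))) = twoHalf (v t) (θ t) (planarSect y)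
  have hc : ∀ s : UnitAddCircle, twoHalf (v t) (θ t) (planarShear (y, s)) = twoHalf (v t) (θ t) (planarSect y) :=
    fun s => twoHalf_add_single (v t) (θ t) s (planarSect y)
  simp_rw [hc]
  rw [integral_const]
  simp

/-- **Joint measurability of the planar section** of a jointly measurable time-dependent
`2½`-dimensional field. [folklore] -/
theorem aestronglyMeasurable_uncurry_of_twoHalf_left
    (h : AEStronglyMeasurable (uncurry fun t => twoHalf (v t) (θ t)) ((volume.restrict S).prod (volume : Measure (UnitAddTorus (Fin 3))))) :
    AEStronglyMeasurable (uncurry v) ((volume.restrict S).prod (volume : Measure (UnitAddTorus (Fin 2)))) := by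
  have h1 := planarProjE.continuous.comp_aestronglyMeasurable (aestronglyMeasurable_uncurry_twoHalf_comp_planarSect h)
  refine h1.congr (ae_of_all _ fun p => ?_)
  obtain ⟨t, y⟩ := p
  exact planarProjE_twoHalf_planarSect (v t) (θ t) y

/-- **Joint measurability of the vertical section** of a jointly measurable time-dependent
`2½`-dimensional field. [folklore] -/
theorem aestronglyMeasurable_uncurry_of_twoHalf_right
    (h : AEStronglyMeasurable (uncurry fun t => twoHalf (v t) (θ t)) ((volume.restrict S).prod (volume : Measure (UnitAddTorus (Fin 3))))) :
    AEStronglyMeasurable (uncurry θ) ((volume.restrict S).prod (volume : Measure (UnitAddTorus (Fin 2)))) := by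
  have h1 := (EuclideanSpace.proj (2 : Fin 3) : (EuclideanSpace ℝ (Fin 3)) →L[ℝ] ℝ).continuous.comp_aestronglyMeasurable
    (aestronglyMeasurable_uncurry_twoHalf_comp_planarSect h)
  refine h1.congr (ae_of_all _ fun p => ?_)
  obtain ⟨t, y⟩ := p
  exact twoHalf_planarSect_two (v t) (θ t) y

/-- Joint measurability of the sections from that of the space–time lift of the field on
`S × ℝ³` (the form recorded by the fluid solution classes). [folklore] -/
theorem aestronglyMeasurable_stLift_of_twoHalf
    (h : AEStronglyMeasurable (stLift fun t => twoHalf (v t) (θ t)) (volume.restrict (S ×ˢ univ))) :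
    AEStronglyMeasurable (stLift v) (volume.restrict (S ×ˢ (univ : Set (EuclideanSpace ℝ (Fin 2))))) ∧
      AEStronglyMeasurable (stLift θ) (volume.restrict (S ×ˢ (univ : Set (EuclideanSpace ℝ (Fin 2))))) := by
  have h' := aestronglyMeasurable_uncurry_of_stLift_prod h
  exact ⟨aestronglyMeasurable_stLift_of_uncurry (aestronglyMeasurable_uncurry_of_twoHalf_left h'),
    aestronglyMeasurable_stLift_of_uncurry (aestronglyMeasurable_uncurry_of_twoHalf_right h')⟩

end Measurability

/-! ## `Lᵖ` comparison and the energy identity for `L²` data -/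

section Lp

variable {V : (UnitAddTorus (Fin 2)) → (EuclideanSpace ℝ (Fin 2))} {R : (UnitAddTorus (Fin 2)) → ℝ}

/-- **Lower integrals of the planar section are dominated**, with no measurability:
`∫⁻ ‖V‖ₑ² ≤ ∫⁻ ‖(V,R)∘π‖ₑ²` (`lintegral_map_le` along the measure-preserving `π`). [folklore] -/
theorem lintegral_enorm_sq_left_le_twoHalf (V : (UnitAddTorus (Fin 2)) → (EuclideanSpace ℝ (Fin 2))) (R : (UnitAddTorus (Fin 2)) → ℝ) :
    ∫⁻ y, ‖V y‖ₑ ^ 2 ≤ ∫⁻ x, ‖twoHalf V R x‖ₑ ^ 2 := by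
  have h := lintegral_map_le (μ := (volume : Measure (UnitAddTorus (Fin 3)))) (fun y : (UnitAddTorus (Fin 2)) => ‖V y‖ₑ ^ 2) planarProj
  rw [measurePreserving_planarProj.map_eq] at h
  refine h.trans (lintegral_mono fun x => ?_)
  gcongr
  rw [← ofReal_norm, ← ofReal_norm]
  exact ENNReal.ofReal_le_ofReal (norm_left_le_norm_twoHalf V R x)

/-- **Lower integrals of the vertical section are dominated**, with no measurability:
`∫⁻ ‖R‖ₑ² ≤ ∫⁻ ‖(V,R)∘π‖ₑ²`. [folklore] -/
theorem lintegral_enorm_sq_right_le_twoHalf (V : (UnitAddTorus (Fin 2)) → (EuclideanSpace ℝ (Fin 2))) (R : (UnitAddTorus (Fin 2)) → ℝ) :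
    ∫⁻ y, ‖R y‖ₑ ^ 2 ≤ ∫⁻ x, ‖twoHalf V R x‖ₑ ^ 2 := by
  have h := lintegral_map_le (μ := (volume : Measure (UnitAddTorus (Fin 3)))) (fun y : (UnitAddTorus (Fin 2)) => ‖R y‖ₑ ^ 2) planarProj
  rw [measurePreserving_planarProj.map_eq] at h
  refine h.trans (lintegral_mono fun x => ?_)
  gcongr
  rw [← ofReal_norm, ← ofReal_norm]
  exact ENNReal.ofReal_le_ofReal (norm_right_le_norm_twoHalf V R x)

/-- `‖V‖_{Lᵖ(T²)} ≤ ‖(V,R)∘π‖_{Lᵖ(T³)}` for measurable `V`. [folklore] -/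
theorem eLpNorm_left_le_twoHalf (hV : AEStronglyMeasurable V volume) (R : (UnitAddTorus (Fin 2)) → ℝ) (p : ℝ≥0∞) :
    eLpNorm V p volume ≤ eLpNorm (twoHalf V R) p (volume : Measure (UnitAddTorus (Fin 3))) := by
  rw [← eLpNorm_twoHalf_zero_right hV p]
  refine eLpNorm_mono fun x => ?_
  rw [norm_twoHalf_zero_right]
  exact norm_left_le_norm_twoHalf V R x

/-- `‖R‖_{Lᵖ(T²)} ≤ ‖(V,R)∘π‖_{Lᵖ(T³)}` for measurable `R`. [folklore] -/
theorem eLpNorm_right_le_twoHalf (V : (UnitAddTorus (Fin 2)) → (EuclideanSpace ℝ (Fin 2))) (hR : AEStronglyMeasurable R volume) (p : ℝ≥0∞) :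
    eLpNorm R p volume ≤ eLpNorm (twoHalf V R) p (volume : Measure (UnitAddTorus (Fin 3))) := by
  rw [← eLpNorm_twoHalf_zero_left hR p]
  refine eLpNorm_mono fun x => ?_
  rw [norm_twoHalf_zero_left]
  exact norm_right_le_norm_twoHalf V R x

/-- **`Lᵖ` descent**: the sections of an `Lᵖ` `2½`-dimensional field are `Lᵖ`. [folklore] -/
theorem memLp_of_twoHalf {p : ℝ≥0∞} (h : MemLp (twoHalf V R) p (volume : Measure (UnitAddTorus (Fin 3)))) :
    MemLp V p volume ∧ MemLp R p volume := by
  have hV := aestronglyMeasurable_of_twoHalf_left h.1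
  have hR := aestronglyMeasurable_of_twoHalf_right h.1
  exact ⟨⟨hV, (eLpNorm_left_le_twoHalf hV R p).trans_lt h.2⟩, ⟨hR, (eLpNorm_right_le_twoHalf V hR p).trans_lt h.2⟩⟩

/-- `Lᵖ` lift and descent are equivalent (`1 ≤ p`). [folklore] -/
theorem memLp_twoHalf_iff {p : ℝ≥0∞} (hp : 1 ≤ p) :
    MemLp (twoHalf V R) p (volume : Measure (UnitAddTorus (Fin 3))) ↔ MemLp V p volume ∧ MemLp R p volume :=
  ⟨memLp_of_twoHalf, fun h => memLp_twoHalf hp h.1 h.2⟩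

/-- Integrability descends to the sections. [folklore] -/
theorem integrable_of_twoHalf (h : Integrable (twoHalf V R) (volume : Measure (UnitAddTorus (Fin 3)))) :
    Integrable V volume ∧ Integrable R volume := by
  rw [← memLp_one_iff_integrable] at h ⊢
  rw [← memLp_one_iff_integrable]
  exact memLp_of_twoHalf h

/-- **Energy of a `2½`-dimensional field with `L²` data**:
`∫_{T³} ‖(V,R)∘π‖² = ∫_{T²} ‖V‖² + ∫_{T²} R²` (the `L²` form of `integral_norm_sq_twoHalf`). [folklore] -/
theorem integral_norm_sq_twoHalf_of_memLp (hV : MemLp V 2 volume) (hR : MemLp R 2 volume) :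
    ∫ x, ‖twoHalf V R x‖ ^ 2 = (∫ y, ‖V y‖ ^ 2) + ∫ y, R y ^ 2 := by
  have hVi : Integrable (fun y => ‖V y‖ ^ 2) volume := hV.integrable_norm_pow two_ne_zero
  have hRi : Integrable (fun y => R y ^ 2) volume := by
    have h := hR.integrable_norm_pow two_ne_zero
    refine h.congr (ae_of_all _ fun y => ?_)
    simp only [Real.norm_eq_abs, sq_abs]
  simp_rw [norm_sq_twoHalf]
  rw [integral_comp_planarProj (b := fun y => ‖V y‖ ^ 2 + R y ^ 2) (hVi.add hRi).aestronglyMeasurable]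
  exact integral_add hVi hRi

/-- The kinetic energy of a `2½`-dimensional field with `L²` data splits:
`E((V,R)∘π) = E(V) + ½‖R‖²_{L²}`. [folklore] -/
theorem kineticEnergy_twoHalf_of_memLp (hV : MemLp V 2 volume) (hR : MemLp R 2 volume) :
    kineticEnergy (twoHalf V R) = kineticEnergy V + 2⁻¹ * scalarL2Sq R := by
  unfold kineticEnergy scalarL2Sq
  rw [integral_norm_sq_twoHalf_of_memLp hV hR, mul_add]

end Lp

/-! ## Weak incompressibility of the planar section -/

section DivFree

variable {V : (UnitAddTorus (Fin 2)) → (EuclideanSpace ℝ (Fin 2))} {R : (UnitAddTorus (Fin 2)) → ℝ}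

/-- **Weak incompressibility descends**: if `(V,R)∘π ∈ L²` is weakly divergence free on `T³`
and `V ∈ L²(T²)`, then `V` is weakly divergence free on `T²` (test `∇(φ∘π) = (∇φ, 0)∘π`). [folklore] -/
theorem isWeaklyDivFree_of_twoHalf (hV : MemLp V 2 volume)
    (h : FunctionSpaces.Torus.IsWeaklyDivFree (twoHalf V R)) : FunctionSpaces.Torus.IsWeaklyDivFree V := by
  intro φ hφ
  have h1 := h (φ ∘ planarProj) hφ.comp_planarProj
  rw [gradient_comp_planarProj (hφ.isContDiff (by simp)),
    integral_inner_twoHalf_eq_add (integrable_inner_of_memLp_two hV (hφ.gradient.memLp 2)) (by simp)] at h1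
  simpa using h1

end DivFree

/-! ## Pairings with purely planar / purely vertical fields -/

section Pairing

variable {V W : (UnitAddTorus (Fin 2)) → (EuclideanSpace ℝ (Fin 2))} {R g : (UnitAddTorus (Fin 2)) → ℝ}

/-- **Pairing with a purely planar field only sees the planar section**:
`∫_{T³} ⟪(V,R)∘π, (W,0)∘π⟫ = ∫_{T²} ⟪V, W⟫` for `V, W ∈ L²`. [folklore] -/
theorem integral_inner_twoHalf_planar (hV : MemLp V 2 volume) (hW : MemLp W 2 volume) (R : (UnitAddTorus (Fin 2)) → ℝ) :
    ∫ x, ⟪twoHalf V R x, twoHalf W 0 x⟫_ℝ = ∫ y, ⟪V y, W y⟫_ℝ := by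
  rw [integral_inner_twoHalf_eq_add (integrable_inner_of_memLp_two hV hW) (by simp)]
  simp

/-- **Pairing with a purely vertical field only sees the vertical section**:
`∫_{T³} ⟪(V,R)∘π, (0,g)∘π⟫ = ∫_{T²} R g` for `R, g ∈ L²`. [folklore] -/
theorem integral_inner_twoHalf_vertical (V : (UnitAddTorus (Fin 2)) → (EuclideanSpace ℝ (Fin 2))) (hR : MemLp R 2 volume) (hg : MemLp g 2 volume) :
    ∫ x, ⟪twoHalf V R x, twoHalf 0 g x⟫_ℝ = ∫ y, R y * g y := by
  rw [integral_inner_twoHalf_eq_add (by simp) (hR.integrable_mul hg)]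
  simp

end Pairing

end Torus

end Literature.Analysis.FluidPDE

end
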